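import Mathlib.NumberTheory.AbelSummation
import Mathlib.NumberTheory.LSeries.SumCoeff
import Mathlib.NumberTheory.LSeries.Dirichlet
import Mathlib.MeasureTheory.Integral.DominatedConvergence
import Mathlib.Analysis.SpecialFunctions.ImproperIntegrals
import Mathlib.Analysis.Complex.ExponentialBounds
import Literature.NumberTheory.LFunctions.MoebiusSumClassicalBound
import HarnessLib

/-!
# `∑_{n ≤ x} μ(n)/n ≪ exp(-c √log x)` and `∑ μ(n)/n = 0` (from the bound for `M(x)`)

Topic `Literature/NumberTheory/LFunctions` (trunk T-ANT). Everything in this file is PROVED.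

From the classical bound `|M(x)| ≤ C x exp(-c√log x)` for `M(x) = ∑_{n ≤ x} μ(n)`
(`Literature.NumberTheory.LFunctions.abs_sum_moebius_le_mul_exp_neg_sqrt_log`, `MoebiusSumClassicalBound.lean`) we derive the
logarithmically weighted form and the value of the complete sum:

* `Literature.NumberTheory.LFunctions.abs_sum_moebius_div_le_exp_neg_sqrt_log` — `|∑_{n ≤ x} μ(n)/n| ≤ C' exp(-(c/2)√log x)`
  (`x ≥ 2`; Landau, *Handbuch* §160; Montgomery–Vaughan §6.2);
* `Literature.NumberTheory.LFunctions.tendsto_sum_moebius_div_zero` — `∑_{n ≤ N} μ(n)/n → 0`, i.e. `∑ μ(n)/n = 0`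
  (von Mangoldt 1897).

Proof. Abel summation (Mathlib `sum_mul_eq_sub_sub_integral_mul` with `f(t) = 1/t`) gives
`∑_{n ≤ x} μ(n)/n = M(x)/x + ∫_1^x M(t) t⁻² dt` (`MoebiusSum.sum_moebius_div_eq`); the integral
converges absolutely on `(1, ∞)` (`MoebiusSum.integrableOn_sum_div_sq`, majorant
`3/t² + C exp(-c√log t)/t`, the latter integrable since `exp(-a√u) ≤ 24/(a⁴u²)`), and its tail
beyond `x` is `≤ C K exp(-(c/2)√log x)` (`MoebiusSum.abs_integral_Ioi_sum_div_sq_le`). The complete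
integral VANISHES (`MoebiusSum.integral_sum_div_sq_eq_zero`): for `δ > 0`,
`(1+δ) ∫_1^∞ M(t) t^{-2-δ} dt = L(μ, 1+δ) = 1/ζ(1+δ)` (Mathlib `LSeries_eq_mul_integral`,
`LSeries_one_mul_Lseries_moebius`), which tends to `0` as `δ → 0⁺` by the pole of `ζ`
(`riemannZeta_residue_one`), while the integrals tend to `∫_1^∞ M t⁻²` by dominated convergence.
Hence `∑_{n ≤ x} μ(n)/n = M(x)/x - ∫_x^∞ M t⁻² ≪ exp(-(c/2)√log x)`.

These are the inputs the `F(w, z)`-type bounds require in Friedlander–Iwaniec's proof of the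
Möbius–density cancellation (2.4) (`Literature.NumberTheory.Sieve.fi_moebius_density_cancellation`, pp. 1048–1049).

## References

* H. L. Montgomery, R. C. Vaughan, *Multiplicative Number Theory I*, CUP 2007, §6.2 and §8.1
  [MontgomeryVaughan2007].

## Mathlib search

Mathlib: `sum_mul_eq_sub_sub_integral_mul` (Abel summation), `LSeries_eq_mul_integral`,
`LSeries_one_mul_Lseries_moebius`, `LSeries_one_eq_riemannZeta`, `riemannZeta_residue_one`,
`MeasureTheory.tendsto_integral_filter_of_dominated_convergence`, `integrableOn_Ioi_rpow_of_lt`,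
`integrableOn_Ioi_deriv_of_nonneg'`, `Real.pow_div_factorial_le_exp`. The tree: only RH-conditional
statements on `∑ μ(n)/n` / `M(x)` (`MertensBoundRH`, `LittlewoodCriterion`) and the new
`MoebiusSumClassicalBound`; nothing on `∑ μ(n)/n = 0`
(`lean search 'moebius.*div|sum_moebius_div'`).
-/

noncomputable section

open Real MeasureTheory Set Filter Topology Finset
open scoped ArithmeticFunction.Moebius

namespace Literature.NumberTheory.LFunctions

namespace MoebiusSum


/-- `exp(-y) ≤ 24 / y⁴` for `y > 0` (from `y⁴/4! ≤ exp y`). [folklore] -/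
theorem exp_neg_le_div_pow_four {y : ℝ} (hy : 0 < y) : Real.exp (-y) ≤ 24 / y ^ 4 := by
  have h : y ^ 4 / 24 ≤ Real.exp y := by
    have := Real.pow_div_factorial_le_exp (x := y) hy.le 4
    norm_num [Nat.factorial] at this
    linarith
  rw [Real.exp_neg, inv_le_comm₀ (Real.exp_pos y) (by positivity), inv_div]
  exact h

/-- `exp(-a √u) ≤ 24 / (a⁴ u²)` for `a, u > 0`. [folklore] -/
theorem exp_neg_mul_sqrt_le {a u : ℝ} (ha : 0 < a) (hu : 0 < u) :
    Real.exp (-(a * Real.sqrt u)) ≤ 24 / (a ^ 4 * u ^ 2) := by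
  have h := exp_neg_le_div_pow_four (mul_pos ha (Real.sqrt_pos.2 hu))
  have hsq : (a * Real.sqrt u) ^ 4 = a ^ 4 * u ^ 2 := by
    have h2 : Real.sqrt u ^ 2 = u := Real.sq_sqrt hu.le
    calc (a * Real.sqrt u) ^ 4 = a ^ 4 * (Real.sqrt u ^ 2) ^ 2 := by ring
      _ = a ^ 4 * u ^ 2 := by rw [h2]
  rwa [hsq] at h

/-- `t ↦ 1 / (t (log t)²)` is integrable on `(e, ∞)` (`= -d/dt (1/log t)`). [folklore] -/
theorem integrableOn_inv_mul_log_sq :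
    IntegrableOn (fun t : ℝ => 1 / (t * Real.log t ^ 2)) (Ioi (Real.exp 1)) volume := by
  have he : 0 < Real.exp 1 := Real.exp_pos 1
  refine integrableOn_Ioi_deriv_of_nonneg' (g := fun t => -(Real.log t)⁻¹) (l := 0) ?_ ?_ ?_
  · intro t ht
    have ht0 : 0 < t := he.trans_le ht
    have hlog : 0 < Real.log t := by
      have : 1 ≤ Real.log t := by rw [← Real.log_exp 1]; exact Real.log_le_log he ht
      linarith
    have h1 : HasDerivAt Real.log t⁻¹ t := Real.hasDerivAt_log ht0.ne'
    have h2 := (h1.inv hlog.ne').neg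
    exact h2.congr_deriv (by rw [neg_div, neg_neg, div_eq_mul_inv, one_div, mul_inv])
  · intro t ht
    have ht0 : 0 < t := he.trans ht
    have hl : 0 < Real.log t := by
      have h1 : 1 ≤ Real.log t := by
        rw [← Real.log_exp 1]; exact Real.log_le_log he (le_of_lt ht)
      linarith
    positivity
  · have : Tendsto (fun t : ℝ => (Real.log t)⁻¹) atTop (𝓝 0) :=
      tendsto_inv_atTop_zero.comp Real.tendsto_log_atTop
    simpa using this.neg

/-- `t ↦ exp(-a √log t) / t` is integrable on `(1, ∞)` for `a > 0`. [folklore] -/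
theorem integrableOn_exp_neg_mul_sqrt_log_div {a : ℝ} (ha : 0 < a) :
    IntegrableOn (fun t : ℝ => Real.exp (-(a * Real.sqrt (Real.log t))) / t) (Ioi 1) volume := by
  have he : 1 < Real.exp 1 := by have := Real.exp_one_gt_d9; linarith
  have hmeas : Measurable fun t : ℝ => Real.exp (-(a * Real.sqrt (Real.log t))) / t :=
    ((Real.measurable_log.sqrt.const_mul a).neg.exp).div measurable_id
  have hsplit : Ioi (1 : ℝ) = Ioc 1 (Real.exp 1) ∪ Ioi (Real.exp 1) :=
    (Ioc_union_Ioi_eq_Ioi he.le).symm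
  rw [hsplit]
  refine IntegrableOn.union ?_ ?_
  · -- bounded by `1` on the finite interval
    refine IntegrableOn.of_bound (measure_Ioc_lt_top) hmeas.aestronglyMeasurable 1 ?_
    refine ae_restrict_of_forall_mem measurableSet_Ioc fun t ht => ?_
    have ht0 : 0 < t := zero_lt_one.trans ht.1
    rw [Real.norm_eq_abs, abs_of_nonneg (div_nonneg (Real.exp_pos _).le ht0.le)]
    calc Real.exp (-(a * Real.sqrt (Real.log t))) / t ≤ 1 / t := by
          refine div_le_div_of_nonneg_right ?_ ht0.le
          exact Real.exp_le_one_iff.2 (neg_nonpos.2 (by positivity))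
      _ ≤ 1 := (div_le_one ht0).2 ht.1.le
  · -- dominated by `24/a⁴ · 1/(t log² t)` beyond `e`
    refine Integrable.mono' ((integrableOn_inv_mul_log_sq).const_mul (24 / a ^ 4))
      hmeas.aestronglyMeasurable ?_
    refine ae_restrict_of_forall_mem measurableSet_Ioi fun t ht => ?_
    have ht0 : 0 < t := (Real.exp_pos 1).trans ht
    have hlog : 0 < Real.log t := by
      have : 1 ≤ Real.log t := by
        rw [← Real.log_exp 1]; exact Real.log_le_log (Real.exp_pos 1) ht.le
      linarith
    rw [Real.norm_eq_abs, abs_of_nonneg (div_nonneg (Real.exp_pos _).le ht0.le)]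
    have h := exp_neg_mul_sqrt_le ha hlog
    calc Real.exp (-(a * Real.sqrt (Real.log t))) / t ≤ 24 / (a ^ 4 * Real.log t ^ 2) / t :=
          div_le_div_of_nonneg_right h ht0.le
      _ = 24 / a ^ 4 * (1 / (t * Real.log t ^ 2)) := by
          field_simp


/-! ### The summatory function `M(t) = ∑_{k ≤ t} μ(k)` as a function of a real variable -/

/-- `t ↦ ∑_{k ≤ t} c(k)` is measurable (it factors through `⌊t⌋`). [folklore] -/
theorem measurable_sum_Icc_floor (c : ℕ → ℝ) :
    Measurable fun t : ℝ => ∑ k ∈ Finset.Icc 0 ⌊t⌋₊, c k :=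
  (Measurable.of_discrete (f := fun n : ℕ => ∑ k ∈ Finset.Icc 0 n, c k)).comp Nat.measurable_floor

/-- `|M(t)| ≤ t + 1` for `t ≥ 0`. [folklore] -/
theorem abs_sum_Icc_moebius_le {t : ℝ} (ht : 0 ≤ t) :
    |∑ k ∈ Finset.Icc 0 ⌊t⌋₊, (μ k : ℝ)| ≤ t + 1 := by
  calc |∑ k ∈ Finset.Icc 0 ⌊t⌋₊, (μ k : ℝ)| ≤ ∑ k ∈ Finset.Icc 0 ⌊t⌋₊, |(μ k : ℝ)| :=
        Finset.abs_sum_le_sum_abs _ _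
    _ ≤ ∑ k ∈ Finset.Icc 0 ⌊t⌋₊, (1 : ℝ) := Finset.sum_le_sum fun k _ => by
        exact_mod_cast ArithmeticFunction.abs_moebius_le_one
    _ = ⌊t⌋₊ + 1 := by simp
    _ ≤ t + 1 := by linarith [Nat.floor_le ht]

/-- `∑_{0 ≤ k ≤ n} μ(k) = ∑_{0 < k ≤ n} μ(k)` (`μ(0) = 0`). [folklore] -/
theorem sum_Icc_zero_moebius_eq_sum_Ioc (n : ℕ) :
    ∑ k ∈ Finset.Icc 0 n, (μ k : ℝ) = ∑ k ∈ Finset.Ioc 0 n, (μ k : ℝ) := by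
  rw [Finset.Icc_eq_cons_Ioc (Nat.zero_le n), Finset.sum_cons, ArithmeticFunction.map_zero,
    Int.cast_zero, zero_add]

/-! ### Abel summation: `m(x) = M(x)/x + ∫_1^x M(t) dt/t²` -/

/-- **Partial summation for `∑ μ(k)/k`**: for `x ≥ 1`,
`∑_{k ≤ x} μ(k)/k = M(x)/x + ∫_1^x M(t) t^{-2} dt`. [folklore] -/
theorem sum_moebius_div_eq (x : ℝ) (hx : 1 ≤ x) :
    ∑ k ∈ Finset.Icc 1 ⌊x⌋₊, (μ k : ℝ) / k =
      (∑ k ∈ Finset.Icc 0 ⌊x⌋₊, (μ k : ℝ)) / x +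
        ∫ t in Set.Ioc 1 x, (∑ k ∈ Finset.Icc 0 ⌊t⌋₊, (μ k : ℝ)) / t ^ 2 := by
  have hx0 : 0 < x := by linarith
  -- Abel summation with `f(t) = t⁻¹` on `[1, x]`
  have hf_diff : ∀ t ∈ Set.Icc (1 : ℝ) x, DifferentiableAt ℝ (fun t : ℝ => t⁻¹) t := fun t ht =>
    differentiableAt_inv_iff.mpr (by linarith [ht.1] : t ≠ 0)
  have hderiv : deriv (fun t : ℝ => t⁻¹) = fun t => -(t ^ 2)⁻¹ := by
    funext t; exact deriv_inv
  have hf_int : IntegrableOn (deriv fun t : ℝ => t⁻¹) (Set.Icc (1 : ℝ) x) := by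
    rw [hderiv]
    refine ContinuousOn.integrableOn_Icc
      (ContinuousOn.neg (ContinuousOn.inv₀ (continuousOn_pow 2) ?_))
    intro t ht; exact pow_ne_zero 2 (by linarith [ht.1] : t ≠ 0)
  have h := sum_mul_eq_sub_sub_integral_mul (fun k => (μ k : ℝ)) zero_le_one hx hf_diff hf_int
  rw [Nat.floor_one] at h
  -- `∑_{Icc 0 1} μ = 1`
  have h01 : ∑ k ∈ Finset.Icc 0 1, (μ k : ℝ) = 1 := by
    rw [sum_Icc_zero_moebius_eq_sum_Ioc, show Finset.Ioc 0 1 = {1} from rfl, Finset.sum_singleton,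
      ArithmeticFunction.moebius_apply_one, Int.cast_one]
  rw [h01, hderiv] at h
  -- split off `k = 1`
  have hsplit : ∑ k ∈ Finset.Icc 1 ⌊x⌋₊, (μ k : ℝ) / k =
      1 + ∑ k ∈ Finset.Ioc 1 ⌊x⌋₊, (μ k : ℝ) / k := by
    rw [Finset.Icc_eq_cons_Ioc (Nat.one_le_iff_ne_zero.mpr (Nat.floor_pos.mpr hx).ne'),
      Finset.sum_cons, ArithmeticFunction.moebius_apply_one]
    simp
  have hsum : ∑ k ∈ Finset.Ioc 1 ⌊x⌋₊, (μ k : ℝ) / k =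
      ∑ k ∈ Finset.Ioc 1 ⌊x⌋₊, (k : ℝ)⁻¹ * (μ k : ℝ) :=
    Finset.sum_congr rfl fun k _ => by rw [div_eq_inv_mul]
  have hint : ∫ t in Set.Ioc 1 x, (fun t : ℝ => -(t ^ 2)⁻¹) t * ∑ k ∈ Finset.Icc 0 ⌊t⌋₊, (μ k : ℝ) =
      -∫ t in Set.Ioc 1 x, (∑ k ∈ Finset.Icc 0 ⌊t⌋₊, (μ k : ℝ)) / t ^ 2 := by
    rw [← integral_neg]
    refine setIntegral_congr_fun measurableSet_Ioc fun t _ => ?_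
    simp only [div_eq_mul_inv]
    ring
  rw [hsplit, hsum, h, hint]
  ring

/-! ### Integrability of `M(t)/t²` and the tail, from a bound `|M(x)| ≤ C x exp(-c√log x)` -/

section FromBound

variable {c₀ C₀ : ℝ}

/-- Pointwise domination of `|M(t)/t²|` by the integrable majorant `3/t² + C₀ exp(-c₀√log t)/t`
(`3/t²` on `(1, 2]`, the bound on `M` beyond). [folklore] -/
theorem abs_sum_div_sq_le (hC₀ : 0 ≤ C₀)
    (hMb : ∀ x : ℝ, 2 ≤ x → |∑ k ∈ Finset.Icc 0 ⌊x⌋₊, (μ k : ℝ)| ≤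
      C₀ * x * Real.exp (-(c₀ * Real.sqrt (Real.log x)))) {t : ℝ} (ht : 1 < t) :
    |(∑ k ∈ Finset.Icc 0 ⌊t⌋₊, (μ k : ℝ)) / t ^ 2| ≤
      3 / t ^ 2 + C₀ * (Real.exp (-(c₀ * Real.sqrt (Real.log t))) / t) := by
  have ht0 : 0 < t := by linarith
  rw [abs_div, abs_of_pos (pow_pos ht0 2)]
  rcases le_or_gt t 2 with h2 | h2
  · have hM : |∑ k ∈ Finset.Icc 0 ⌊t⌋₊, (μ k : ℝ)| ≤ 3 := by
      linarith [abs_sum_Icc_moebius_le ht0.le]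
    calc |∑ k ∈ Finset.Icc 0 ⌊t⌋₊, (μ k : ℝ)| / t ^ 2 ≤ 3 / t ^ 2 :=
          div_le_div_of_nonneg_right hM (pow_pos ht0 2).le
      _ ≤ 3 / t ^ 2 + C₀ * (Real.exp (-(c₀ * Real.sqrt (Real.log t))) / t) :=
          le_add_of_nonneg_right (by positivity)
  · calc |∑ k ∈ Finset.Icc 0 ⌊t⌋₊, (μ k : ℝ)| / t ^ 2
        ≤ C₀ * t * Real.exp (-(c₀ * Real.sqrt (Real.log t))) / t ^ 2 :=
          div_le_div_of_nonneg_right (hMb t h2.le) (pow_pos ht0 2).le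
      _ = C₀ * (Real.exp (-(c₀ * Real.sqrt (Real.log t))) / t) := by
          field_simp
      _ ≤ _ := le_add_of_nonneg_left (by positivity)

/-- `t ↦ 3/t²` is integrable on `(1, ∞)`. [folklore] -/
theorem integrableOn_three_div_sq : IntegrableOn (fun t : ℝ => 3 / t ^ 2) (Set.Ioi 1) volume := by
  have h := (integrableOn_Ioi_rpow_of_lt (by norm_num : (-2 : ℝ) < -1) zero_lt_one).const_mul 3
  refine IntegrableOn.congr_fun h (fun t ht => ?_) measurableSet_Ioi
  have ht0 : 0 < t := zero_lt_one.trans ht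
  rw [Real.rpow_neg ht0.le, Real.rpow_two, div_eq_mul_inv]

/-- **`M(t)/t²` is integrable on `(1, ∞)`** under the bound `|M(x)| ≤ C₀ x exp(-c₀√log x)`
(`x ≥ 2`). [folklore] -/
theorem integrableOn_sum_div_sq (hc₀ : 0 < c₀) (hC₀ : 0 ≤ C₀)
    (hMb : ∀ x : ℝ, 2 ≤ x → |∑ k ∈ Finset.Icc 0 ⌊x⌋₊, (μ k : ℝ)| ≤
      C₀ * x * Real.exp (-(c₀ * Real.sqrt (Real.log x)))) :
    IntegrableOn (fun t : ℝ => (∑ k ∈ Finset.Icc 0 ⌊t⌋₊, (μ k : ℝ)) / t ^ 2) (Set.Ioi 1)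
      volume := by
  have hmeas : Measurable fun t : ℝ => (∑ k ∈ Finset.Icc 0 ⌊t⌋₊, (μ k : ℝ)) / t ^ 2 :=
    (measurable_sum_Icc_floor _).div (measurable_id.pow_const 2)
  refine Integrable.mono' (integrableOn_three_div_sq.add
    ((integrableOn_exp_neg_mul_sqrt_log_div hc₀).const_mul C₀)) hmeas.aestronglyMeasurable ?_
  refine ae_restrict_of_forall_mem measurableSet_Ioi fun t ht => ?_
  rw [Real.norm_eq_abs]
  exact abs_sum_div_sq_le hC₀ hMb ht

/-- **The tail of the integral**: for `x ≥ 2`,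
`|∫_x^∞ M(t) t^{-2} dt| ≤ C₀ K exp(-(c₀/2)√log x)` with `K = ∫_1^∞ exp(-(c₀/2)√log t) dt/t`.
[folklore] -/
theorem abs_integral_Ioi_sum_div_sq_le (hc₀ : 0 < c₀) (hC₀ : 0 ≤ C₀)
    (hMb : ∀ x : ℝ, 2 ≤ x → |∑ k ∈ Finset.Icc 0 ⌊x⌋₊, (μ k : ℝ)| ≤
      C₀ * x * Real.exp (-(c₀ * Real.sqrt (Real.log x)))) {x : ℝ} (hx : 2 ≤ x) :
    |∫ t in Set.Ioi x, (∑ k ∈ Finset.Icc 0 ⌊t⌋₊, (μ k : ℝ)) / t ^ 2| ≤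
      C₀ * (∫ t in Set.Ioi 1, Real.exp (-(c₀ / 2 * Real.sqrt (Real.log t))) / t) *
        Real.exp (-(c₀ / 2 * Real.sqrt (Real.log x))) := by
  have hx1 : 1 < x := by linarith
  set K := ∫ t in Set.Ioi 1, Real.exp (-(c₀ / 2 * Real.sqrt (Real.log t))) / t with hK
  set Ex := Real.exp (-(c₀ / 2 * Real.sqrt (Real.log x))) with hEx
  have hK0 : 0 ≤ K := setIntegral_nonneg measurableSet_Ioi fun t ht =>
    div_nonneg (Real.exp_pos _).le (zero_le_one.trans ht.le)
  have hsub : Set.Ioi x ⊆ Set.Ioi 1 := Set.Ioi_subset_Ioi hx1.le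
  have hint : IntegrableOn (fun t : ℝ => (∑ k ∈ Finset.Icc 0 ⌊t⌋₊, (μ k : ℝ)) / t ^ 2)
      (Set.Ioi x) :=
    (integrableOn_sum_div_sq hc₀ hC₀ hMb).mono_set hsub
  have hdom : IntegrableOn (fun t : ℝ => Real.exp (-(c₀ / 2 * Real.sqrt (Real.log t))) / t)
      (Set.Ioi 1) := integrableOn_exp_neg_mul_sqrt_log_div (half_pos hc₀)
  -- pointwise: `|M t|/t² ≤ C₀ Ex · e^{-(c₀/2)√log t}/t` for `t ≥ x`
  have hpt : ∀ t ∈ Set.Ioi x, |(∑ k ∈ Finset.Icc 0 ⌊t⌋₊, (μ k : ℝ)) / t ^ 2| ≤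
      C₀ * Ex * (Real.exp (-(c₀ / 2 * Real.sqrt (Real.log t))) / t) := by
    intro t ht
    have ht2 : 2 ≤ t := hx.trans (le_of_lt ht)
    have ht0 : 0 < t := by linarith
    rw [abs_div, abs_of_pos (pow_pos ht0 2)]
    have hsqrt : Real.sqrt (Real.log x) ≤ Real.sqrt (Real.log t) :=
      Real.sqrt_le_sqrt (Real.log_le_log (by linarith) ht.le)
    have hexp : Real.exp (-(c₀ * Real.sqrt (Real.log t))) ≤
        Ex * Real.exp (-(c₀ / 2 * Real.sqrt (Real.log t))) := by
      rw [hEx, ← Real.exp_add]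
      exact Real.exp_le_exp.2 (by nlinarith [hc₀.le])
    calc |∑ k ∈ Finset.Icc 0 ⌊t⌋₊, (μ k : ℝ)| / t ^ 2
        ≤ C₀ * t * Real.exp (-(c₀ * Real.sqrt (Real.log t))) / t ^ 2 :=
          div_le_div_of_nonneg_right (hMb t ht2) (pow_pos ht0 2).le
      _ = C₀ * (Real.exp (-(c₀ * Real.sqrt (Real.log t))) / t) := by field_simp
      _ ≤ C₀ * (Ex * Real.exp (-(c₀ / 2 * Real.sqrt (Real.log t))) / t) :=
          mul_le_mul_of_nonneg_left (div_le_div_of_nonneg_right hexp ht0.le) hC₀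
      _ = C₀ * Ex * (Real.exp (-(c₀ / 2 * Real.sqrt (Real.log t))) / t) := by ring
  calc |∫ t in Set.Ioi x, (∑ k ∈ Finset.Icc 0 ⌊t⌋₊, (μ k : ℝ)) / t ^ 2|
      ≤ ∫ t in Set.Ioi x, |(∑ k ∈ Finset.Icc 0 ⌊t⌋₊, (μ k : ℝ)) / t ^ 2| :=
        abs_integral_le_integral_abs
    _ ≤ ∫ t in Set.Ioi x, C₀ * Ex * (Real.exp (-(c₀ / 2 * Real.sqrt (Real.log t))) / t) := by
        refine setIntegral_mono_on hint.abs ((hdom.mono_set hsub).const_mul _) measurableSet_Ioi hpt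
    _ = C₀ * Ex * ∫ t in Set.Ioi x, Real.exp (-(c₀ / 2 * Real.sqrt (Real.log t))) / t := by
        rw [integral_const_mul]
    _ ≤ C₀ * Ex * K := by
        refine mul_le_mul_of_nonneg_left ?_ (by positivity)
        refine setIntegral_mono_set hdom ?_ hsub.eventuallyLE
        exact ae_restrict_of_forall_mem measurableSet_Ioi fun t ht =>
          div_nonneg (Real.exp_pos _).le (zero_le_one.trans ht.le)
    _ = C₀ * K * Ex := by ring

end FromBound

/-! ### `∫_1^∞ M(t) t^{-2} dt = 0`: the Abelian argument through `L(μ, s) = 1/ζ(s)` -/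

section LimitZero

/-- `∑_{1 ≤ k ≤ n} μ(k)` (complex) is the real `M(n)`. [folklore] -/
theorem sum_Icc_one_moebius_complex (n : ℕ) :
    (∑ k ∈ Finset.Icc 1 n, (μ k : ℂ)) = ((∑ k ∈ Finset.Icc 0 n, (μ k : ℝ) : ℝ) : ℂ) := by
  have hI : Finset.Icc 1 n = Finset.Ioc 0 n := by
    simpa using Finset.Icc_add_one_left_eq_Ioc 0 n
  rw [hI, sum_Icc_zero_moebius_eq_sum_Ioc]
  push_cast
  rfl

/-- **`L(μ, 1+δ) = (1+δ) ∫_1^∞ M(t) t^{-2-δ} dt` and `L(μ, 1+δ) = 1/ζ(1+δ)`** (`δ > 0`).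
[folklore] -/
theorem inv_riemannZeta_eq_mul_integral {δ : ℝ} (hδ : 0 < δ) :
    (riemannZeta ((1 + δ : ℝ) : ℂ))⁻¹ =
      ((1 + δ : ℝ) : ℂ) * ((∫ t in Set.Ioi 1,
        (∑ k ∈ Finset.Icc 0 ⌊t⌋₊, (μ k : ℝ)) * t ^ (-(2 + δ)) : ℝ) : ℂ) := by
  set s : ℂ := ((1 + δ : ℝ) : ℂ) with hs
  have hsre : 1 < s.re := by
    rw [hs, Complex.ofReal_re]; linarith
  -- `L(μ, s) = ζ(s)⁻¹`
  have hμ : LSeries (fun n : ℕ => (μ n : ℂ)) s = (riemannZeta s)⁻¹ := by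
    have h := LSeries_one_mul_Lseries_moebius hsre
    rw [LSeries_one_eq_riemannZeta hsre] at h
    exact eq_inv_of_mul_eq_one_right h
  -- the integral representation
  have hS : LSeriesSummable (fun n : ℕ => (μ n : ℂ)) s :=
    LSeriesSummable_of_bounded_of_one_lt_re (m := 1) (fun n _ => by
      rw [Complex.norm_intCast]; exact_mod_cast ArithmeticFunction.abs_moebius_le_one) hsre
  have hO : (fun n : ℕ => ∑ k ∈ Finset.Icc 1 n, (μ k : ℂ)) =O[atTop]
      fun n => (n : ℝ) ^ (1 : ℝ) := by
    refine Asymptotics.IsBigO.of_bound 1 (Filter.Eventually.of_forall fun n => ?_)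
    rw [Real.norm_eq_abs, abs_of_nonneg (by positivity), Real.rpow_one, one_mul]
    calc ‖∑ k ∈ Finset.Icc 1 n, (μ k : ℂ)‖ ≤ ∑ k ∈ Finset.Icc 1 n, ‖(μ k : ℂ)‖ := norm_sum_le _ _
      _ ≤ ∑ k ∈ Finset.Icc 1 n, (1 : ℝ) := Finset.sum_le_sum fun k _ => by
          rw [Complex.norm_intCast]; exact_mod_cast ArithmeticFunction.abs_moebius_le_one
      _ = n := by simp
  have hint := LSeries_eq_mul_integral (fun n : ℕ => (μ n : ℂ)) zero_le_one
    (by rw [hs, Complex.ofReal_re]; linarith) hS hO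
  rw [hμ] at hint
  rw [hint]
  congr 1
  rw [show (((∫ t in Set.Ioi 1, (∑ k ∈ Finset.Icc 0 ⌊t⌋₊, (μ k : ℝ)) * t ^ (-(2 + δ)) : ℝ)) : ℂ) =
      ∫ t in Set.Ioi 1, (((∑ k ∈ Finset.Icc 0 ⌊t⌋₊, (μ k : ℝ)) * t ^ (-(2 + δ)) : ℝ) : ℂ) from
    integral_ofReal.symm]
  refine setIntegral_congr_fun measurableSet_Ioi fun t ht => ?_
  have ht0 : 0 < t := zero_lt_one.trans ht
  have h2 : (t : ℂ) ^ (-(s + 1)) = ((t ^ (-(2 + δ)) : ℝ) : ℂ) := by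
    rw [Complex.ofReal_cpow ht0.le]
    congr 1
    rw [hs]; push_cast; ring
  rw [sum_Icc_one_moebius_complex, h2]
  push_cast
  ring

/-- `ζ(1+δ)⁻¹ → 0` as `δ → 0⁺` (the pole of `ζ` at `1`). [folklore] -/
theorem tendsto_inv_riemannZeta_one_add :
    Tendsto (fun δ : ℝ => (riemannZeta ((1 + δ : ℝ) : ℂ))⁻¹) (𝓝[>] 0) (𝓝 0) := by
  -- `s(δ) = 1 + δ → 1` within `{1}ᶜ`
  have hsδ : Tendsto (fun δ : ℝ => ((1 + δ : ℝ) : ℂ)) (𝓝[>] 0) (𝓝[≠] 1) := by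
    refine tendsto_nhdsWithin_of_tendsto_nhds_of_eventually_within _ ?_ ?_
    · have : Continuous fun δ : ℝ => ((1 + δ : ℝ) : ℂ) := by fun_prop
      simpa using (this.tendsto 0).mono_left nhdsWithin_le_nhds
    · filter_upwards [self_mem_nhdsWithin] with δ hδ
      simp only [Set.mem_compl_iff, Set.mem_singleton_iff]
      intro h
      have := congrArg Complex.re h
      simp at this
      exact (ne_of_gt (Set.mem_Ioi.mp hδ)) this
  have hres := riemannZeta_residue_one.comp hsδ
  -- `ζ(s)⁻¹ = (s - 1) · ((s - 1) ζ(s))⁻¹`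
  have hsm1 : Tendsto (fun δ : ℝ => ((1 + δ : ℝ) : ℂ) - 1) (𝓝[>] 0) (𝓝 0) := by
    have : Continuous fun δ : ℝ => ((1 + δ : ℝ) : ℂ) - 1 := by fun_prop
    simpa using (this.tendsto 0).mono_left nhdsWithin_le_nhds
  have hprod := hsm1.mul (hres.inv₀ one_ne_zero)
  rw [inv_one, zero_mul] at hprod
  refine hprod.congr' ?_
  filter_upwards [self_mem_nhdsWithin] with δ hδ
  have hδ0 : 0 < δ := Set.mem_Ioi.mp hδ
  have hs1 : ((1 + δ : ℝ) : ℂ) - 1 ≠ 0 := by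
    intro h; have := congrArg Complex.re h; simp at this; linarith
  simp only [Function.comp_apply]
  field_simp

variable {c₀ C₀ : ℝ}

/-- **`∫_1^∞ M(t) t^{-2} dt = 0`** under the bound `|M(x)| ≤ C₀ x exp(-c₀√log x)`: the integrals
`∫_1^∞ M(t) t^{-2-δ} dt = ζ(1+δ)⁻¹/(1+δ)` tend to it as `δ → 0⁺` (dominated convergence) and to `0`
(pole of `ζ`). This is `∑ μ(n)/n = 0`. [folklore] -/
theorem integral_sum_div_sq_eq_zero (hc₀ : 0 < c₀) (hC₀ : 0 ≤ C₀)
    (hMb : ∀ x : ℝ, 2 ≤ x → |∑ k ∈ Finset.Icc 0 ⌊x⌋₊, (μ k : ℝ)| ≤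
      C₀ * x * Real.exp (-(c₀ * Real.sqrt (Real.log x)))) :
    ∫ t in Set.Ioi 1, (∑ k ∈ Finset.Icc 0 ⌊t⌋₊, (μ k : ℝ)) / t ^ 2 = 0 := by
  set M : ℝ → ℝ := fun t => ∑ k ∈ Finset.Icc 0 ⌊t⌋₊, (μ k : ℝ) with hMdef
  set L : ℝ := ∫ t in Set.Ioi 1, M t / t ^ 2 with hL
  have hLint : IntegrableOn (fun t : ℝ => M t / t ^ 2) (Set.Ioi 1) :=
    integrableOn_sum_div_sq hc₀ hC₀ hMb
  -- dominated convergence: `∫ M t^{-2-δ} → ∫ M t^{-2} = L` as `δ → 0⁺`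
  have hDCT : Tendsto (fun δ : ℝ => ∫ t in Set.Ioi 1, M t * t ^ (-(2 + δ))) (𝓝[>] 0) (𝓝 L) := by
    have hL' : L = ∫ t in Set.Ioi 1, M t * t ^ (-(2 + (0 : ℝ))) := by
      rw [hL]
      refine setIntegral_congr_fun measurableSet_Ioi fun t ht => ?_
      have ht0 : 0 < t := zero_lt_one.trans ht
      simp only [add_zero]
      rw [Real.rpow_neg ht0.le, Real.rpow_two, div_eq_mul_inv]
    rw [hL']
    refine tendsto_integral_filter_of_dominated_convergence (fun t => |M t / t ^ 2|) ?_ ?_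
      hLint.abs ?_
    · filter_upwards [self_mem_nhdsWithin] with δ _
      exact ((measurable_sum_Icc_floor _).mul
        (measurable_id.pow_const _)).aestronglyMeasurable
    · filter_upwards [self_mem_nhdsWithin] with δ hδ
      have hδ0 : 0 < δ := Set.mem_Ioi.mp hδ
      refine ae_restrict_of_forall_mem measurableSet_Ioi fun t ht => ?_
      have ht0 : 0 < t := zero_lt_one.trans ht
      rw [Real.norm_eq_abs, abs_mul, abs_div, abs_of_pos (pow_pos ht0 2),
        abs_of_pos (Real.rpow_pos_of_pos ht0 _), div_eq_mul_inv]
      refine mul_le_mul_of_nonneg_left ?_ (abs_nonneg _)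
      rw [← Real.rpow_two, ← Real.rpow_neg ht0.le]
      exact Real.rpow_le_rpow_of_exponent_le ht.le (by linarith)
    · refine ae_restrict_of_forall_mem measurableSet_Ioi fun t ht => ?_
      have ht0 : 0 < t := zero_lt_one.trans ht
      refine Tendsto.const_mul _ ?_
      have hcont : Continuous fun δ : ℝ => t ^ (-(2 + δ)) :=
        (Real.continuous_const_rpow ht0.ne').comp (by fun_prop)
      exact (hcont.tendsto 0).mono_left nhdsWithin_le_nhds
  -- the same integrals through `ζ`: `(1+δ) ∫ … = ζ(1+δ)⁻¹ → 0`, and `(1+δ) → 1`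
  have hC : Tendsto (fun δ : ℝ => ((1 + δ : ℝ) : ℂ) *
      ((∫ t in Set.Ioi 1, M t * t ^ (-(2 + δ)) : ℝ) : ℂ)) (𝓝[>] 0) (𝓝 ((1 : ℂ) * (L : ℂ))) := by
    refine Tendsto.mul ?_ ?_
    · have : Continuous fun δ : ℝ => ((1 + δ : ℝ) : ℂ) := by fun_prop
      simpa using (this.tendsto 0).mono_left nhdsWithin_le_nhds
    · exact (Complex.continuous_ofReal.tendsto L).comp hDCT
  have hC' : Tendsto (fun δ : ℝ => ((1 + δ : ℝ) : ℂ) *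
      ((∫ t in Set.Ioi 1, M t * t ^ (-(2 + δ)) : ℝ) : ℂ)) (𝓝[>] 0) (𝓝 0) := by
    refine tendsto_inv_riemannZeta_one_add.congr' ?_
    filter_upwards [self_mem_nhdsWithin] with δ hδ
    exact inv_riemannZeta_eq_mul_integral (Set.mem_Ioi.mp hδ)
  have huniq := tendsto_nhds_unique hC hC'
  rw [one_mul, Complex.ofReal_eq_zero] at huniq
  exact huniq

end LimitZero

/-! ### The bound for `m(x) = ∑_{n ≤ x} μ(n)/n` -/

/-- **`∑_{n ≤ x} μ(n)/n ≪ exp(-c√log x)` from `M(x) ≪ x exp(-c₀√log x)`**: for `x ≥ 2`,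
`|m(x)| ≤ (C₀ + C₀ K) exp(-(c₀/2)√log x)`, `K = ∫_1^∞ exp(-(c₀/2)√log t) dt/t`, since
`m(x) = M(x)/x + ∫_1^x M t^{-2} = M(x)/x - ∫_x^∞ M t^{-2}` (`∫_1^∞ M t^{-2} = 0`). [folklore] -/
theorem abs_sum_moebius_div_le_of_bound {c₀ C₀ : ℝ} (hc₀ : 0 < c₀) (hC₀ : 0 ≤ C₀)
    (hMb : ∀ x : ℝ, 2 ≤ x → |∑ k ∈ Finset.Icc 0 ⌊x⌋₊, (μ k : ℝ)| ≤
      C₀ * x * Real.exp (-(c₀ * Real.sqrt (Real.log x)))) {x : ℝ} (hx : 2 ≤ x) :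
    |∑ k ∈ Finset.Icc 1 ⌊x⌋₊, (μ k : ℝ) / k| ≤
      (C₀ + C₀ * ∫ t in Set.Ioi 1, Real.exp (-(c₀ / 2 * Real.sqrt (Real.log t))) / t) *
        Real.exp (-(c₀ / 2 * Real.sqrt (Real.log x))) := by
  have hx1 : 1 ≤ x := by linarith
  have hx0 : 0 < x := by linarith
  set K := ∫ t in Set.Ioi 1, Real.exp (-(c₀ / 2 * Real.sqrt (Real.log t))) / t with hK
  have hLint := integrableOn_sum_div_sq hc₀ hC₀ hMb
  -- `∫_1^x = ∫_1^∞ - ∫_x^∞ = -∫_x^∞`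
  have hsplit : ∫ t in Set.Ioc 1 x, (∑ k ∈ Finset.Icc 0 ⌊t⌋₊, (μ k : ℝ)) / t ^ 2 =
      -∫ t in Set.Ioi x, (∑ k ∈ Finset.Icc 0 ⌊t⌋₊, (μ k : ℝ)) / t ^ 2 := by
    have hunion : Set.Ioc 1 x ∪ Set.Ioi x = Set.Ioi 1 := Set.Ioc_union_Ioi_eq_Ioi hx1
    have hdisj : Disjoint (Set.Ioc 1 x) (Set.Ioi x) := fun u hu1 hu2 t ht =>
      absurd (lt_of_lt_of_le (Set.mem_Ioi.mp (hu2 ht)) (Set.mem_Ioc.mp (hu1 ht)).2) (lt_irrefl _)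
    have h := setIntegral_union hdisj measurableSet_Ioi (hLint.mono_set Set.Ioc_subset_Ioi_self)
      (hLint.mono_set (Set.Ioi_subset_Ioi hx1))
    rw [hunion, integral_sum_div_sq_eq_zero hc₀ hC₀ hMb] at h
    linarith
  rw [sum_moebius_div_eq x hx1, hsplit, ← sub_eq_add_neg]
  have h1 : |(∑ k ∈ Finset.Icc 0 ⌊x⌋₊, (μ k : ℝ)) / x| ≤
      C₀ * Real.exp (-(c₀ / 2 * Real.sqrt (Real.log x))) := by
    rw [abs_div, abs_of_pos hx0, div_le_iff₀ hx0]
    have : Real.exp (-(c₀ * Real.sqrt (Real.log x))) ≤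
        Real.exp (-(c₀ / 2 * Real.sqrt (Real.log x))) :=
      Real.exp_le_exp.2 (by nlinarith [Real.sqrt_nonneg (Real.log x), hc₀.le])
    calc |∑ k ∈ Finset.Icc 0 ⌊x⌋₊, (μ k : ℝ)|
          ≤ C₀ * x * Real.exp (-(c₀ * Real.sqrt (Real.log x))) := hMb x hx
      _ ≤ C₀ * x * Real.exp (-(c₀ / 2 * Real.sqrt (Real.log x))) :=
          mul_le_mul_of_nonneg_left this (mul_nonneg hC₀ hx0.le)
      _ = C₀ * Real.exp (-(c₀ / 2 * Real.sqrt (Real.log x))) * x := by ring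
  have h2 := abs_integral_Ioi_sum_div_sq_le hc₀ hC₀ hMb hx
  calc |(∑ k ∈ Finset.Icc 0 ⌊x⌋₊, (μ k : ℝ)) / x -
        ∫ t in Set.Ioi x, (∑ k ∈ Finset.Icc 0 ⌊t⌋₊, (μ k : ℝ)) / t ^ 2|
      ≤ |(∑ k ∈ Finset.Icc 0 ⌊x⌋₊, (μ k : ℝ)) / x| +
          |∫ t in Set.Ioi x, (∑ k ∈ Finset.Icc 0 ⌊t⌋₊, (μ k : ℝ)) / t ^ 2| := abs_sub _ _
    _ ≤ C₀ * Real.exp (-(c₀ / 2 * Real.sqrt (Real.log x))) +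
          C₀ * K * Real.exp (-(c₀ / 2 * Real.sqrt (Real.log x))) := add_le_add h1 h2
    _ = (C₀ + C₀ * K) * Real.exp (-(c₀ / 2 * Real.sqrt (Real.log x))) := by ring

/-! ### Unconditional statements, from `M(x) ≪ x exp(-c√log x)` -/

/-- The bound of `…MoebiusSumClassicalBound` in the `∑_{0 ≤ k ≤ ⌊x⌋}` normalisation with a
nonnegative constant. [folklore] -/
theorem exists_abs_sum_Icc_moebius_le :
    ∃ c₀ : ℝ, 0 < c₀ ∧ ∃ C₀ : ℝ, 0 ≤ C₀ ∧ ∀ x : ℝ, 2 ≤ x →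
      |∑ k ∈ Finset.Icc 0 ⌊x⌋₊, (μ k : ℝ)| ≤
        C₀ * x * Real.exp (-(c₀ * Real.sqrt (Real.log x))) := by
  obtain ⟨c₀, hc₀, C, hM⟩ := abs_sum_moebius_le_mul_exp_neg_sqrt_log
  refine ⟨c₀, hc₀, max C 0, le_max_right _ _, fun x hx => ?_⟩
  rw [sum_Icc_zero_moebius_eq_sum_Ioc]
  refine (hM x hx).trans ?_
  rw [neg_mul]
  exact mul_le_mul_of_nonneg_right (mul_le_mul_of_nonneg_right (le_max_left _ _) (by linarith))
    (Real.exp_pos _).le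

end MoebiusSum

open MoebiusSum in
/-- **`∑_{n ≤ x} μ(n)/n ≪ exp(-c √log x)`** (de la Vallée-Poussin–Landau; Landau, *Handbuch*
§§159–160; Montgomery–Vaughan §6.2): there are `c > 0` and `C` with
`|∑_{n ≤ x} μ(n)/n| ≤ C exp(-c√log x)` for all `x ≥ 2`. From `M(x) ≪ x exp(-c₀√log x)`
(`Literature.NumberTheory.LFunctions.abs_sum_moebius_le_mul_exp_neg_sqrt_log`) by partial summation
`m(x) = M(x)/x + ∫_1^x M(t)t⁻² dt` and `∫_1^∞ M(t)t⁻² dt = 0`, the latter because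
`(1+δ)∫_1^∞ M(t) t^{-2-δ} dt = L(μ, 1+δ) = 1/ζ(1+δ) → 0` as `δ → 0⁺` while the integrals tend to
`∫_1^∞ M t⁻²` by dominated convergence. [cite: MontgomeryVaughan2007, Theorem 6.9 (6.12)] -/
theorem abs_sum_moebius_div_le_exp_neg_sqrt_log :
    ∃ c : ℝ, 0 < c ∧ ∃ C : ℝ, ∀ x : ℝ, 2 ≤ x →
      |∑ k ∈ Finset.Icc 1 ⌊x⌋₊, (μ k : ℝ) / k| ≤ C * Real.exp (-c * Real.sqrt (Real.log x)) := by
  obtain ⟨c₀, hc₀, C₀, hC₀, hMb⟩ := exists_abs_sum_Icc_moebius_le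
  refine ⟨c₀ / 2, half_pos hc₀,
    C₀ + C₀ * ∫ t in Set.Ioi 1, Real.exp (-(c₀ / 2 * Real.sqrt (Real.log t))) / t, fun x hx => ?_⟩
  have h := abs_sum_moebius_div_le_of_bound hc₀ hC₀ hMb hx
  rwa [neg_mul]

open MoebiusSum in
/-- **`∑_{n=1}^∞ μ(n)/n = 0`** (von Mangoldt 1897 / Landau; equivalent to the prime number theorem):
the partial sums `∑_{n ≤ N} μ(n)/n` tend to `0`. [cite: MontgomeryVaughan2007, §8.1 (8.6)] -/
theorem tendsto_sum_moebius_div_zero :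
    Tendsto (fun N : ℕ => ∑ k ∈ Finset.Icc 1 N, (μ k : ℝ) / k) atTop (𝓝 0) := by
  obtain ⟨c, hc, C, h⟩ := abs_sum_moebius_div_le_exp_neg_sqrt_log
  have hlim : Tendsto (fun N : ℕ => C * Real.exp (-c * Real.sqrt (Real.log N))) atTop
      (𝓝 (C * 0)) := by
    refine Tendsto.const_mul C ?_
    refine Real.tendsto_exp_atBot.comp ?_
    have h1 : Tendsto (fun N : ℕ => Real.sqrt (Real.log N)) atTop atTop :=
      Real.tendsto_sqrt_atTop.comp (Real.tendsto_log_atTop.comp tendsto_natCast_atTop_atTop)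
    exact h1.const_mul_atTop_of_neg (by linarith : -c < 0)
  rw [mul_zero] at hlim
  refine squeeze_zero_norm' ?_ hlim
  filter_upwards [eventually_ge_atTop 2] with N hN
  rw [Real.norm_eq_abs]
  have := h N (by exact_mod_cast hN)
  rwa [Nat.floor_natCast] at this

end Literature.NumberTheory.LFunctions
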